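import Mathlib
import Summits.QuantumFields.YangMills.Theorems.EguchiKawaiDirectionLadderHaarWeightedPattern
import Summits.QuantumFields.YangMills.Theorems.EguchiKawaiDirectionLadderHaarOffDiagSmallBall
import HarnessLib

/-!
# Entrywise (multiscale) rigidity of a Haar unitary

The `N`-uniform ENTRYWISE small-ball bound (route `EguchiKawaiDirectionLadder`, crux
`TripleSmallBallMargin`, stub plan A1 «generic-region count»; the rigidity factor of the conditional
triple bound): for weights `x_{jk} ≥ 0` on the entries below the diagonal which are monotone along
columns (`x_{jk} ≤ x_{jl}` for `l ≤ k < j` — e.g. `x_{jk} = (λ_j − λ_k)²` for a sorted real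
configuration `λ`) and every `t > 0`,

  `Haar{W ∈ U(N) : Σ_{k<j} x_{jk} |W_{jk}|² ≤ N t} ≤ e^{8N²} · ∏_{k<j} (1 + x_{jk}/t)⁻¹`

(`haar_measure_entrywise_le`): every entry `(j,k)` with `x_{jk} ≫ t` contributes its own factor
`≈ t/x_{jk}`, at ALL scales simultaneously, with an `e^{O(N²)}` constant and no `N^{N²}`.  Proof:
dyadic allocation of the budget over the columns (`exists_alloc`, at most `(⌊log₂N⌋+2)^N ≤ e^{2N²}`
patterns) and the weighted column-by-column bound `haar_measure_weightedPattern_le`; the bookkeeping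
`prod_weightedColBound_le` shows each pattern costs at most `e^{6N²} ∏ (1 + x_{jk}/t)⁻¹`.  All [folklore].
-/

noncomputable section

open MeasureTheory Finset Real
open Literature.Barriers.QuantumFields
open Literature.MathematicalPhysics.QuantumFieldTheory (haarProbability)
open scoped ENNReal

namespace Summit.QuantumFields.YangMills.Theorems.EguchiKawaiDirectionLadder.HaarColumns

/-! ### Bookkeeping -/

/-- `(1 + a/(t 2^α))⁻¹ ≤ 2^α (1 + a/t)⁻¹` for `a ≥ 0`, `t > 0`. [folklore] -/
theorem inv_one_add_div_mul_le {a t : ℝ} (ha : 0 ≤ a) (ht : 0 < t) (α : ℕ) :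
    (1 + a / (t * 2 ^ α))⁻¹ ≤ 2 ^ α * (1 + a / t)⁻¹ := by
  have h2 : (1 : ℝ) ≤ 2 ^ α := one_le_pow₀ (by norm_num)
  have hpos1 : 0 < 1 + a / (t * 2 ^ α) := by positivity
  have hpos2 : 0 < 1 + a / t := by positivity
  rw [inv_le_comm₀ hpos1 (by positivity), mul_inv, inv_inv, ← div_eq_inv_mul,
    div_le_iff₀ (by positivity)]
  have : (1 + a / (t * 2 ^ α)) * 2 ^ α = 2 ^ α + a / t := by
    field_simp
  rw [this]
  linarith

/-- **Per-pattern bookkeeping** for the weighted bound: with budgets `β_k = t 2^{α_k}`,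
`Σ 2^{α_k} ≤ 3N`: `∏_k 2^N e^{(Σ_{l<k}β_l)/β_k} ∏_j (1 + A_{kj}/β_k)⁻¹ ≤ e^{6N²} ∏_k ∏_j (1 + A_{kj}/t)⁻¹`.
[folklore] -/
theorem prod_weightedColBound_le {N : ℕ} (A : Fin N → Fin N → ℝ) (hA : ∀ k j, 0 ≤ A k j)
    (α : Fin N → ℕ) (hα : ∑ k, 2 ^ (α k) ≤ 3 * N) {t : ℝ} (ht : 0 < t) :
    ∏ k, ((2 : ℝ) ^ N * Real.exp ((∑ l ∈ Finset.univ.filter (· < k), t * 2 ^ (α l)) / (t * 2 ^ (α k))) *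
        ∏ j, (1 + A k j / (t * 2 ^ (α k)))⁻¹) ≤
      Real.exp (6 * (N : ℝ) ^ 2) * ∏ k, ∏ j, (1 + A k j / t)⁻¹ := by
  have two_pow_le_exp : ∀ n : ℕ, (2 : ℝ) ^ n ≤ Real.exp n := by
    intro n
    have h2 : (2 : ℝ) ≤ Real.exp 1 := by
      have := Real.add_one_le_exp (1 : ℝ); linarith
    calc (2 : ℝ) ^ n ≤ (Real.exp 1) ^ n := pow_le_pow_left₀ (by norm_num) h2 n
      _ = Real.exp n := by rw [← Real.exp_nat_mul, mul_one]
  have hαsum : ∑ k, α k ≤ 2 * N := sum_le_two_mul_of_sum_two_pow_le α hα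
  have hαsumR : ∑ k, (2 : ℝ) ^ (α k) ≤ 3 * N := by exact_mod_cast hα
  have hinv0 : ∀ k j (c : ℝ), 0 < c → 0 ≤ (1 + A k j / c)⁻¹ := fun k j c hc =>
    inv_nonneg.2 (add_nonneg zero_le_one (div_nonneg (hA k j) hc.le))
  -- per column
  have hcol : ∀ k, (2 : ℝ) ^ N * Real.exp ((∑ l ∈ Finset.univ.filter (· < k), t * 2 ^ (α l)) /
        (t * 2 ^ (α k))) * ∏ j, (1 + A k j / (t * 2 ^ (α k)))⁻¹ ≤
      ((2 : ℝ) ^ N * Real.exp (3 * N) * 2 ^ (α k * N)) * ∏ j, (1 + A k j / t)⁻¹ := by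
    intro k
    have h1 : (∑ l ∈ Finset.univ.filter (· < k), t * 2 ^ (α l)) / (t * 2 ^ (α k)) ≤ 3 * N := by
      rw [div_le_iff₀ (by positivity)]
      calc ∑ l ∈ Finset.univ.filter (· < k), t * 2 ^ (α l) ≤ ∑ l, t * 2 ^ (α l) :=
            Finset.sum_le_sum_of_subset_of_nonneg (Finset.filter_subset _ _) fun l _ _ => by positivity
        _ = t * ∑ l, (2 : ℝ) ^ (α l) := by rw [Finset.mul_sum]
        _ ≤ t * (3 * N) := by gcongr
        _ ≤ 3 * N * (t * 2 ^ (α k)) := by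
            have : t ≤ t * 2 ^ (α k) := le_mul_of_one_le_right ht.le (one_le_pow₀ (by norm_num))
            nlinarith
    have h2 : ∏ j, (1 + A k j / (t * 2 ^ (α k)))⁻¹ ≤ 2 ^ (α k * N) * ∏ j, (1 + A k j / t)⁻¹ := by
      calc ∏ j, (1 + A k j / (t * 2 ^ (α k)))⁻¹ ≤ ∏ j, (2 ^ (α k) * (1 + A k j / t)⁻¹) :=
            Finset.prod_le_prod (fun j _ => hinv0 k j _ (by positivity)) fun j _ =>
              inv_one_add_div_mul_le (hA k j) ht _
        _ = 2 ^ (α k * N) * ∏ j, (1 + A k j / t)⁻¹ := by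
            rw [Finset.prod_mul_distrib, Finset.prod_const, Finset.card_univ, Fintype.card_fin, ← pow_mul]
    calc (2 : ℝ) ^ N * Real.exp ((∑ l ∈ Finset.univ.filter (· < k), t * 2 ^ (α l)) / (t * 2 ^ (α k))) *
          ∏ j, (1 + A k j / (t * 2 ^ (α k)))⁻¹
        ≤ (2 : ℝ) ^ N * Real.exp (3 * N) * (2 ^ (α k * N) * ∏ j, (1 + A k j / t)⁻¹) := by
          refine mul_le_mul ?_ h2 (Finset.prod_nonneg fun j _ => hinv0 k j _ (by positivity)) (by positivity)
          exact mul_le_mul_of_nonneg_left (Real.exp_le_exp.2 h1) (by positivity)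
      _ = ((2 : ℝ) ^ N * Real.exp (3 * N) * 2 ^ (α k * N)) * ∏ j, (1 + A k j / t)⁻¹ := by ring
  refine (Finset.prod_le_prod (fun k _ => mul_nonneg (by positivity)
    (Finset.prod_nonneg fun j _ => hinv0 k j _ (by positivity))) fun k _ => hcol k).trans ?_
  rw [Finset.prod_mul_distrib]
  refine mul_le_mul_of_nonneg_right ?_ (Finset.prod_nonneg fun k _ => Finset.prod_nonneg fun j _ =>
    hinv0 k j t ht)
  -- the constants
  rw [Finset.prod_mul_distrib, Finset.prod_mul_distrib, Finset.prod_const, Finset.prod_const,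
    Finset.card_univ, Fintype.card_fin, Finset.prod_pow_eq_pow_sum, ← pow_mul]
  have hsum : ∑ k, α k * N ≤ 2 * N * N := by
    rw [← Finset.sum_mul]; exact Nat.mul_le_mul_right _ hαsum
  have hA' : (2 : ℝ) ^ (N * N) ≤ Real.exp ((N : ℝ) ^ 2) := by
    calc (2 : ℝ) ^ (N * N) ≤ Real.exp ((N * N : ℕ) : ℝ) := two_pow_le_exp _
      _ = Real.exp ((N : ℝ) ^ 2) := by push_cast; ring_nf
  have hB' : (Real.exp (3 * N)) ^ N = Real.exp (3 * (N : ℝ) ^ 2) := by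
    rw [← Real.exp_nat_mul]; ring_nf
  have hC' : (2 : ℝ) ^ (∑ k, α k * N) ≤ Real.exp (2 * (N : ℝ) ^ 2) := by
    calc (2 : ℝ) ^ (∑ k, α k * N) ≤ 2 ^ (2 * N * N) := pow_le_pow_right₀ (by norm_num) hsum
      _ ≤ Real.exp ((2 * N * N : ℕ) : ℝ) := two_pow_le_exp _
      _ = Real.exp (2 * (N : ℝ) ^ 2) := by push_cast; ring_nf
  calc (2 : ℝ) ^ (N * N) * Real.exp (3 * N) ^ N * 2 ^ (∑ k, α k * N)
      ≤ Real.exp ((N : ℝ) ^ 2) * Real.exp (3 * (N : ℝ) ^ 2) * Real.exp (2 * (N : ℝ) ^ 2) := by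
        rw [hB']; gcongr
    _ = Real.exp (6 * (N : ℝ) ^ 2) := by rw [← Real.exp_add, ← Real.exp_add]; congr 1; ring

/-! ### The main bound -/

/-- **Entrywise rigidity of a Haar unitary.** For weights `x_{jk} ≥ 0` monotone along columns
(`x j k ≤ x j l` whenever `l ≤ k < j`) and `t > 0`,
`Haar{W : Σ_{k<j} x_{jk}|W_{jk}|² ≤ N t} ≤ e^{8N²} ∏_{k<j} (1 + x_{jk}/t)⁻¹`. [folklore] -/
theorem haar_measure_entrywise_le {N : ℕ} (x : Fin N → Fin N → ℝ) (hx : ∀ j k, 0 ≤ x j k)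
    (hmono : ∀ j k l : Fin N, l ≤ k → k < j → x j k ≤ x j l) {t : ℝ} (ht : 0 < t) :
    haarProbability (UN N)
        {W : UN N | ∑ k, ∑ j, (if k < j then x j k * ‖(W : Matrix (Fin N) (Fin N) ℂ) j k‖ ^ 2 else 0) ≤ N * t} ≤
      ENNReal.ofReal (Real.exp (8 * (N : ℝ) ^ 2) *
        ∏ k : Fin N, ∏ j : Fin N, (if k < j then (1 + x j k / t)⁻¹ else 1)) := by
  classical
  -- lower-triangular weights, as a function of a natural column index
  set A : Fin N → Fin N → ℝ := fun k j => if k < j then x j k else 0 with hAdef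
  have hA0 : ∀ k j, 0 ≤ A k j := by
    intro k j; simp only [hAdef]; split_ifs <;> simp [hx]
  set a : ℕ → Fin N → ℝ := fun k j => if h : k < N then A ⟨k, h⟩ j else 0 with hadef
  have hak : ∀ k : Fin N, a k = A k := fun k => by funext j; simp [hadef, k.2]
  have ha0 : ∀ k j, 0 ≤ a k j := by
    intro k j; simp only [hadef]; split_ifs <;> simp [hA0]
  have hnest : ∀ l k, l ≤ k → ∀ j, a k j ≤ a l j := by
    intro l k hlk j
    by_cases hk : k < N
    · have hl : l < N := lt_of_le_of_lt hlk hk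
      simp only [hadef, hk, hl, dif_pos, hAdef]
      by_cases hkj : (⟨k, hk⟩ : Fin N) < j
      · have hlj : (⟨l, hl⟩ : Fin N) < j := lt_of_le_of_lt (Fin.mk_le_mk.2 hlk) hkj
        rw [if_pos hkj, if_pos hlj]
        exact hmono j ⟨k, hk⟩ ⟨l, hl⟩ (Fin.mk_le_mk.2 hlk) hkj
      · rw [if_neg hkj]
        split_ifs <;> simp [hx]
    · simp only [hadef, hk, dif_neg, not_false_eq_true]
      exact ha0 l j
  -- the column masses and the event
  have hevent : ∀ W : UN N,
      (∑ k, ∑ j, (if k < j then x j k * ‖(W : Matrix (Fin N) (Fin N) ℂ) j k‖ ^ 2 else 0)) =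
        ∑ k, ∑ j, A k j * ‖(W : Matrix (Fin N) (Fin N) ℂ) j k‖ ^ 2 := by
    intro W
    refine Finset.sum_congr rfl fun k _ => Finset.sum_congr rfl fun j _ => ?_
    simp only [hAdef]; split_ifs <;> simp
  -- dyadic levels
  set L : ℕ := Nat.log 2 N + 1 with hL
  have hNL : N < 2 ^ L := Nat.lt_pow_succ_log_self one_lt_two N
  set G : Finset (Fin N → Fin (L + 1)) :=
    Finset.univ.filter fun α : Fin N → Fin (L + 1) => ∑ k, 2 ^ (α k : ℕ) ≤ 3 * N with hG
  set E : (Fin N → Fin (L + 1)) → Set (UN N) := fun α =>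
    {W : UN N | ∀ k : Fin N, ∑ j, A k j * ‖(W : Matrix (Fin N) (Fin N) ℂ) j k‖ ^ 2 ≤
      t * 2 ^ (α k : ℕ)} with hEdef
  have hsub : {W : UN N | ∑ k, ∑ j, (if k < j then x j k * ‖(W : Matrix (Fin N) (Fin N) ℂ) j k‖ ^ 2
      else 0) ≤ N * t} ⊆ ⋃ α ∈ G, E α := by
    intro W hW
    have hW' : ∑ k, ∑ j, A k j * ‖(W : Matrix (Fin N) (Fin N) ℂ) j k‖ ^ 2 ≤ N * t := by
      rw [← hevent W]; exact hW
    obtain ⟨α, hαG, hα⟩ := exists_alloc hNL ht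
      (fun k => ∑ j, A k j * ‖(W : Matrix (Fin N) (Fin N) ℂ) j k‖ ^ 2)
      (fun k => Finset.sum_nonneg fun j _ => mul_nonneg (hA0 k j) (by positivity)) hW'
    exact Set.mem_biUnion hαG fun k => hα k
  -- one pattern
  have hone : ∀ α ∈ G, haarProbability (UN N) (E α) ≤
      ENNReal.ofReal (Real.exp (6 * (N : ℝ) ^ 2) * ∏ k, ∏ j, (1 + A k j / t)⁻¹) := by
    intro α hα
    have hαsum : ∑ k, 2 ^ (α k : ℕ) ≤ 3 * N := (Finset.mem_filter.1 hα).2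
    set β : ℕ → ℝ := fun k => if h : k < N then t * 2 ^ (α ⟨k, h⟩ : ℕ) else t with hβ
    have hβk : ∀ k : Fin N, β k = t * 2 ^ (α k : ℕ) := fun k => by simp [hβ, k.2]
    have hβpos : ∀ k, 0 < β k := by
      intro k; simp only [hβ]; split_ifs <;> positivity
    have hev : E α = {W : UN N | ∀ k : Fin N,
        ∑ j, a k j * ‖(W : Matrix (Fin N) (Fin N) ℂ) j k‖ ^ 2 ≤ β k} := by
      ext W; simp only [hEdef, Set.mem_setOf_eq, hak, hβk]
    rw [hev]
    refine (haar_measure_weightedPattern_le a β ha0 hβpos hnest).trans ?_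
    -- rewrite the product over `Fin N`
    have hsumβ : ∀ k : Fin N, ∑ l ∈ Finset.range k, β l =
        ∑ l ∈ Finset.univ.filter (· < k), t * 2 ^ (α l : ℕ) := by
      intro k
      have h1 : ∑ l ∈ Finset.univ.filter (· < k), t * 2 ^ (α l : ℕ) =
          ∑ l : Fin N, (if (l : ℕ) < k then β l else 0) := by
        rw [Finset.sum_filter]
        refine Finset.sum_congr rfl fun l _ => ?_
        by_cases hlk : l < k
        · rw [if_pos hlk, if_pos (Fin.lt_def.1 hlk), hβk]
        · rw [if_neg hlk, if_neg (fun h => hlk (Fin.lt_def.2 h))]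
      have h2 : ∑ l : Fin N, (if (l : ℕ) < k then β l else 0) =
          ∑ l ∈ Finset.range N, (if l < k then β l else 0) :=
        Fin.sum_univ_eq_sum_range (fun l => if l < (k : ℕ) then β l else 0) N
      have h3 : ∑ l ∈ Finset.range N, (if l < (k : ℕ) then β l else 0) = ∑ l ∈ Finset.range k, β l := by
        rw [← Finset.sum_filter]
        congr 1
        ext l
        simp only [Finset.mem_filter, Finset.mem_range]
        constructor
        · exact fun h => h.2
        · exact fun h => ⟨lt_trans h k.2, h⟩
      rw [h1, h2, h3]
    have hprodF : ∏ k ∈ Finset.range N, ENNReal.ofReal (2 ^ N * Real.exp ((∑ l ∈ Finset.range k, β l) / β k) *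
          ∏ j, (1 + a k j / β k)⁻¹) =
        ∏ k : Fin N, ENNReal.ofReal ((2 : ℝ) ^ N *
          Real.exp ((∑ l ∈ Finset.univ.filter (· < k), t * 2 ^ (α l : ℕ)) / (t * 2 ^ (α k : ℕ))) *
            ∏ j, (1 + A k j / (t * 2 ^ (α k : ℕ)))⁻¹) := by
      rw [← Fin.prod_univ_eq_prod_range]
      refine Finset.prod_congr rfl fun k _ => ?_
      rw [hsumβ k, hβk k, hak k]
    rw [hprodF, ← ENNReal.ofReal_prod_of_nonneg (fun k _ => by
      refine mul_nonneg (by positivity) (Finset.prod_nonneg fun j _ => inv_nonneg.2 ?_)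
      have := hA0 k j; positivity)]
    refine ENNReal.ofReal_le_ofReal ?_
    exact prod_weightedColBound_le A hA0 (fun k => (α k : ℕ)) hαsum ht
  -- the product in the statement
  have hprodA : ∏ k, ∏ j, (1 + A k j / t)⁻¹ =
      ∏ k : Fin N, ∏ j : Fin N, (if k < j then (1 + x j k / t)⁻¹ else 1) := by
    refine Finset.prod_congr rfl fun k _ => Finset.prod_congr rfl fun j _ => ?_
    simp only [hAdef]
    split_ifs <;> simp
  have hPnn : 0 ≤ ∏ k, ∏ j, (1 + A k j / t)⁻¹ :=
    Finset.prod_nonneg fun k _ => Finset.prod_nonneg fun j _ => inv_nonneg.2 (by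
      have := hA0 k j; positivity)
  rw [← hprodA]
  -- assemble
  calc haarProbability (UN N) {W : UN N | ∑ k, ∑ j, (if k < j then
          x j k * ‖(W : Matrix (Fin N) (Fin N) ℂ) j k‖ ^ 2 else 0) ≤ N * t}
      ≤ haarProbability (UN N) (⋃ α ∈ G, E α) := measure_mono hsub
    _ ≤ ∑ α ∈ G, haarProbability (UN N) (E α) := measure_biUnion_finset_le _ _
    _ ≤ ∑ α ∈ G, ENNReal.ofReal (Real.exp (6 * (N : ℝ) ^ 2) * ∏ k, ∏ j, (1 + A k j / t)⁻¹) :=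
        Finset.sum_le_sum hone
    _ = G.card * ENNReal.ofReal (Real.exp (6 * (N : ℝ) ^ 2) * ∏ k, ∏ j, (1 + A k j / t)⁻¹) := by
        rw [Finset.sum_const, nsmul_eq_mul]
    _ ≤ ENNReal.ofReal (((L + 1 : ℕ) : ℝ) ^ N) *
          ENNReal.ofReal (Real.exp (6 * (N : ℝ) ^ 2) * ∏ k, ∏ j, (1 + A k j / t)⁻¹) := by
        gcongr
        rw [← ENNReal.ofReal_natCast]
        refine ENNReal.ofReal_le_ofReal ?_
        exact_mod_cast card_allocSet_le N L
    _ = ENNReal.ofReal (((L + 1 : ℕ) : ℝ) ^ N *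
          (Real.exp (6 * (N : ℝ) ^ 2) * ∏ k, ∏ j, (1 + A k j / t)⁻¹)) := by
        rw [← ENNReal.ofReal_mul (by positivity)]
    _ ≤ ENNReal.ofReal (Real.exp (8 * (N : ℝ) ^ 2) * ∏ k, ∏ j, (1 + A k j / t)⁻¹) := by
        refine ENNReal.ofReal_le_ofReal ?_
        have hcard := card_levels_pow_le_exp N
        calc ((L + 1 : ℕ) : ℝ) ^ N * (Real.exp (6 * (N : ℝ) ^ 2) * ∏ k, ∏ j, (1 + A k j / t)⁻¹)
            ≤ Real.exp (2 * (N : ℝ) ^ 2) * (Real.exp (6 * (N : ℝ) ^ 2) * ∏ k, ∏ j, (1 + A k j / t)⁻¹) :=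
              mul_le_mul_of_nonneg_right hcard (mul_nonneg (Real.exp_pos _).le hPnn)
          _ = Real.exp (8 * (N : ℝ) ^ 2) * ∏ k, ∏ j, (1 + A k j / t)⁻¹ := by
              rw [← mul_assoc, ← Real.exp_add]; congr 1; congr 1; ring

end Summit.QuantumFields.YangMills.Theorems.EguchiKawaiDirectionLadder.HaarColumns

end
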